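import Literature.MathematicalPhysics.QuantumFieldTheory.Balaban1983to89.B9ResidualEntriesAtOne
import Literature.MathematicalPhysics.QuantumFieldTheory.Balaban1983to89.B9Ineq347AllEntries

/-!
# `Balaban1983to89.B9Ineq347Reading` — [B9] p. 398 «the global inequalities (3.47) are consequences of the local ones (3.42)
# and Lemma 2.1», kernel-checked AT THE READING LEVEL of the typed kernel families (`B9.KernelFamily.e` ⇒ `.glob`), so that the
# (3.47) leaves at U = 1 of the N06 knit (`B9ResidualEntriesAtOne.AtOneGlobOn`, obligations `hGp`∕`hGA` rows 11–12) reduce to the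
# (3.42) entries at U = 1 + [4] Lemma 2.1 + four READING AXIOMS of the operator layer

T. Bałaban, *Propagators for lattice gauge theories in a background field*, Commun. Math. Phys. **99** (1985) 389–434
[`Balaban1985BackgroundPropagators`, "B9"]; [4] = T. Bałaban, *Propagators and renormalization transformations for lattice
gauge theories. II*, Commun. Math. Phys. **96** (1984) 223–250 [`Balaban1984PropagatorsII`].

statement-level skeleton of published theorems with citation tags; proofs where landed; nothing here is a claim about the
Yang–Mills mass gap

THE PRINTED LOCI (verbatim).  p. 397: *"We define for an arbitrary real number α |A|_{(α)} = sup_{0≦j≦k} sup_{b∈Ω_j∖Ω_{j+1}}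
(L^jη)^{−α}|A(b)|. (3.41) Thus the norm |A|_{(α)} can be defined as the smallest number C such, that |A(b)| ≦ C(L^jη)^α for
b ∈ Ω_j∖Ω_{j+1}, j = 0, 1, …, k."*; (3.42) p. 397: *"|(G′(U)λ)(x)|, |(∇_UG′(U)λ)(x)|, |(G′(U)∇*_Uλ)(x)|, |(Δ_UG′(U)λ)(x)| ≦
B₀[(L^jη)², L^jη, L^jη, 1]e^{−δ₀d(y,y′)}|λ| for x ∈ Δ(y), y ∈ Λ_j, supp λ ⊂ Δ(y′)"*; (3.47) p. 398: *"the global inequalities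
|G′(U)λ|_{(2+γ)}, |∇_UG′(U)λ|_{(1+γ)}, |G′(U)∇*_Uλ|_{(1+γ)}, |∇_UG′(U)λ|_{(γ)} ≦ B₀|λ|_{(γ)} (3.47) for γ in a fixed compact
subset of real numbers, e.g. for γ ∈ [−4, 4]"*; p. 398: *"It is easy to see that the global inequalities (3.47) are
consequences of the local ones (3.42) and Lemma 2.1."*  [4] Lemma 2.1 p. 234: (2.60) *"e^{−αδ₀d(y,y′)} ≦
e^{−αδ₀RM max{|j−j′|−1,0}}"*, (2.61) *"sup_{y∈𝔅} Σ_{y′∈𝔅} e^{−αδ₀d(y,y′)} ≦ c₁(α)"*.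

THE POINT.  The implication is in the tree at FUNCTION level (`B9Ineq347AllEntries.glob347_allEntries`, p27: operators
`T_n : (X_n → ℝ) →ₗ (Y_n → ℝ)` with two-space block majorants), but the N06 knit consumes (3.42)∕(3.47) through the ABSTRACT
readings `K.e n U λ y` (= sup_{x∈Δ(y)} |(word_n K(U) λ)(x)|) and `K.glob n U λ γ` (= |word_n K(U) λ|_{(p_n+γ)}) of a
`B9.KernelFamily` over a `B9.Geometry` whose norms `supNorm` = |λ|, `wNorm γ` = |λ|_{(γ)} are fields — and its (3.47) leaves at
U = 1 are `B9ResidualEntriesAtOne.AtOneGlobOn geo bg K P` (the (3.47) member of `B9FromB6.ResidualGpAtOne`, and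
`ResidualGAGlobAtOne`).  THIS FILE redoes the printed route — λ = Σ_{y′}Δ(y′)λ, (3.42) block by block, e^{−δ₀d} =
e^{−(1−α)δ₀d}·e^{−αδ₀d}, scale transfer of the weight (L^{j′}η)^γ to (L^jη)^γ by (2.60) (one factor L^{|γ|} per scale step, under
the located size condition 4·log L ≦ αδ₀RM, p27's `size_condition_compact`), summation by (2.61) — AT THE READING LEVEL, the
four properties of the readings it uses DISPLAYED as a hypothesis structure `GlobReading K P U res` on a sub-family `P` of
arguments (the operator's summand at the carriers of record):
  `res_P`∕`res_supp` — the block pieces Δ(y′)λ of an argument on the summand are arguments on the summand supported in Δ(y′)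
  ([4] (2.52) λ = Σ_{y′}Δ(y′)λ); `res_norm` — |Δ(y′)λ| ≦ (L^{j′}η)^γ|λ|_{(γ)} (the sentence after (3.41)); `e_subadd` — the sup
  reading is sub-additive along the block decomposition (linearity of word_n K(U) + triangle inequality); `glob_le` — the weighted
  reading |word_n K(U)λ|_{(p_n+γ)} is ≦ C as soon as every block reading is ≦ C·[(L^jη)², L^jη, L^jη, 1]_n(L^jη)^γ ((3.41) as
  «the smallest number C such that …»).
Every one holds for sup∕weighted-sup readings of a linear operator (provable at an operator layer the hour it is defined);
none is asserted here.

* §1 `EBlockOn` ((3.42) ON `P`; `eBlockOn_of_eBlock`, `eBlock_iff_on_true`), `GlobReading`.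
* §2 ★ `globBlockOn_of_eBlockOn` — ONE family member, ONE configuration: `EBlockOn K P B₀ δ₀ U` + (2.60), (2.61) at 1 − α (pv08's typed
  `Ineq260`∕`Ineq261` for the transported geometry `B9Thm34Ext.toB6 g R H`) + L ≧ 1, η > 0 + 4·log L ≦ αδ₀RM + `GlobReading` ⇒
  `GlobBlockOn K P (B₀c₁(1−α)L⁴) U` — (3.47) ON `P` with print's ONE constant on the compact set [−4, 4].
* §3 ★ `atOneGlobOn_of_atOneEOn` — the family at U = 1: the (3.42) leaf at U = 1 ON `P` (`AtOneEOn`, ∃ threshold ∃ (B₀, δ₀)),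
  Lemma 2.1 in its printed «RM sufficiently large» form (for the leaf's δ₀ and a fixed 0 < α < 1: an M-threshold above which
  (2.60), (2.61) at 1 − α and the size condition hold), L_i = L ≧ 1, η_i > 0, `GlobReading` at every member ⇒ `AtOneGlobOn geo bg K P`;
  hence (`B9ResidualEntriesAtOne`) ★ `residualGAGlobAtOne_of_atOneEOn_of_null` — the knit's `ResidualGAGlobAtOne geo bg K` from the
  (3.42) leaf at U = 1 ON `P`, Lemma 2.1, the readings, and the null reading OFF `P`.
* §4 at the Stage-3′(Y) carriers over def-Y's signature `ops : ∀ x, OperatorLayerY … x`: ★ `hGA_of_atOneEOn_reading` — the knit binder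
  `hGA` from the (3.42) leaf of G(1) ON BOND ARGUMENTS at U = 1 (in the tree at NODE 00's reading: [4] Prop. 2.6 (2.136), N03), Lemma 2.1
  at the members (N03's [4] block), the glob-readings of `(ops ·).GA`, and the null reading on site arguments; and
  `atOneGlobOn_Gp_of_atOneEOn_reading` — the (3.47) member of `hGp` likewise from the (3.42) leaf of G′(1) ON SITE ARGUMENTS.

HONEST SCOPE.  Nothing of [B9] or [4] asserted: (3.42) at U = 1, Lemma 2.1 and the four reading axioms are HYPOTHESES of printed ∕
definitional shape; the file's content is the printed «easy to see» step, kernel-checked at the level the knit consumes.  What it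
changes for N06: the (3.47) sub-leaves of rows 11–12 (11-Glob(G′), 12-Glob(G)) are no longer free-standing estimates but
consequences of the (3.42) entries at U = 1 (rows 1∕4's currency) + [4] Lemma 2.1 + instance readings; the other sub-leaves of
row 11 ((3.43)Δ̃, (3.44), (3.45), (3.46) for G′(1) — G-B9-03a proper) are untouched.  Count-neutral; NOT a node discharge; one
finite lattice programme — nothing continuum, nothing about the mass gap.  Cell `pub-ymgap` (HUMAN RULING D-0062), Track A node
N06 [B9], N06-ASSIGNMENT v1 rows 11–12 (bundle F3), seat `pub-ymgap-dag-n06-h`, 2026-08-26.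
-/

noncomputable section

namespace Literature.MathematicalPhysics.QuantumFieldTheory.Balaban1983to89.B9Ineq347Reading

open B9FromB6 B9FromB6ModelSignsOn B9ResidualEntriesAtOne
open B6RandomWalk (Ineq260 Ineq261 c1_nonneg)
open B9Ineq347 (ScaleTransfer scaleTransfer_of_260)
open B9Ineq347AllEntries (weight_ratio weight_nonneg size_condition_compact h260_nat_of_Ineq260 rpow_abs_mul_exp_le_one)
open B9Thm34Ext (toB6)
open B6KLevelCensusIndexV1 (KIdx)
open B9GeoNormsKLevelV1 (geo9K)
open B9PinMembersKLevelV1 (MemberY geo9Y bg9Y)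
open B9PinCarriersKLevelV1 (OperatorLayerY)

/-! ## §1 (3.42) ON a sub-family; the reading axioms -/

section One

variable {g : B9.Geometry} {B : B9.Backgrounds}

/-- (3.42) for the arguments `lam` with `P lam` only (the four sup entries, constants (B₀, δ₀), configuration U).
[cite: Balaban1985BackgroundPropagators, (3.42) p.397] -/
def EBlockOn (K : B9.KernelFamily g B) (P : g.Loc → Prop) (B₀ δ₀ : ℝ) (U : B.Cfg) : Prop :=
  ∀ (n : Fin 4) (lam : g.Loc) (y y' : g.Site), P lam → g.suppIn lam y' →
    K.e n U lam y ≤ B₀ * B9.pref4 (g.len y) n * Real.exp (-(δ₀ * g.dist y y')) * g.supNorm lam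

/-- the (3.42) block gives the block ON every sub-family. [cite: Balaban1985BackgroundPropagators, (3.42) p.397 (bookkeeping)] -/
theorem eBlockOn_of_eBlock {K : B9.KernelFamily g B} {P : g.Loc → Prop} {B₀ δ₀ : ℝ} {U : B.Cfg} (h : EBlock K B₀ δ₀ U) :
    EBlockOn K P B₀ δ₀ U :=
  fun n lam y y' _ hs => h n lam y y' hs

/-- ON `P ≡ True` the restricted (3.42) block IS the block. [cite: Balaban1985BackgroundPropagators, (3.42) p.397 (bookkeeping)] -/
theorem eBlock_iff_on_true {K : B9.KernelFamily g B} {B₀ δ₀ : ℝ} {U : B.Cfg} :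
    EBlock K B₀ δ₀ U ↔ EBlockOn K (fun _ => True) B₀ δ₀ U :=
  ⟨eBlockOn_of_eBlock, fun h n lam y y' hs => h n lam y y' trivial hs⟩

/-- **THE READING AXIOMS behind «(3.47) are consequences of (3.42) and Lemma 2.1»** for one kernel family `K` at the configuration
`U`, ON the sub-family `P` of arguments, with block pieces `res y′ λ` = Δ(y′)λ: the pieces of an argument on `P` are on `P`
(`res_P`) and supported in Δ(y′) (`res_supp`, [4] (2.52)); |Δ(y′)λ| ≦ (L^{j′}η)^γ|λ|_{(γ)} (`res_norm`, the sentence after (3.41));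
the sup readings of (3.42) are sub-additive along λ = Σ_{y′}Δ(y′)λ (`e_subadd`); the weighted reading of (3.47) is ≦ C whenever
every block reading is ≦ C·[(L^jη)², L^jη, L^jη, 1]_n·(L^jη)^γ (`glob_le`, (3.41): «the smallest number C such that …»).  A
HYPOTHESIS SCHEMA on how an operator layer reads its operators; nothing asserted.
[cite: Balaban1985BackgroundPropagators, (3.41)–(3.42) p.397 + (3.47) p.398; Balaban1984PropagatorsII, (2.52) p.232] -/
structure GlobReading [Fintype g.Site] (K : B9.KernelFamily g B) (P : g.Loc → Prop) (U : B.Cfg)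
    (res : g.Site → g.Loc → g.Loc) : Prop where
  res_P : ∀ (y' : g.Site) (lam : g.Loc), P lam → P (res y' lam)
  res_supp : ∀ (y' : g.Site) (lam : g.Loc), P lam → g.suppIn (res y' lam) y'
  res_norm : ∀ (y' : g.Site) (lam : g.Loc) (γ : ℝ), P lam → g.supNorm (res y' lam) ≤ (g.len y') ^ γ * g.wNorm γ lam
  e_subadd : ∀ (n : Fin 4) (lam : g.Loc) (y : g.Site), P lam → K.e n U lam y ≤ ∑ y' : g.Site, K.e n U (res y' lam) y
  glob_le : ∀ (n : Fin 4) (lam : g.Loc) (γ C : ℝ), P lam → 0 ≤ C →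
    (∀ y : g.Site, K.e n U lam y ≤ C * B9.pref4 (g.len y) n * (g.len y) ^ γ) → K.glob n U lam γ ≤ C

end One

/-! ## §2 (3.42) ON `P` + Lemma 2.1 + the readings ⇒ (3.47) ON `P`, one member, one configuration -/

section Member

variable {g : B9.Geometry} [Fintype g.Site] {B : B9.Backgrounds} {R : ℝ} {H : Prop}

omit [Fintype g.Site] in
/-- Lʲη ≥ 0 for L ≥ 1, η > 0. [folklore] -/
private theorem len_nonneg' (hL : 1 ≤ g.L) (hη : 0 < g.eta) (y : g.Site) : 0 ≤ g.len y :=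
  mul_nonneg (pow_nonneg (le_trans zero_le_one hL) _) hη.le

/-- ★ **«IT IS EASY TO SEE THAT THE GLOBAL INEQUALITIES (3.47) ARE CONSEQUENCES OF THE LOCAL ONES (3.42) AND LEMMA 2.1» — AT THE
READING LEVEL, ALL FOUR ENTRIES, γ ∈ [−4, 4].**  For one kernel family `K` at `U`: (3.42) ON `P` with (B₀, δ₀) (B₀ ≧ 0), [4]'s
(2.60) at α and (2.61) at 1 − α for the transported geometry, L ≧ 1, η > 0, the size condition 4·log L ≦ αδ₀RM, |·|_{(γ)} ≧ 0, and
the reading axioms `GlobReading K P U res` give (3.47) ON `P` with the ONE constant B₀c₁(1−α)L⁴ (c₁ = `B6.c1 d δ₀ (1 − α)`).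
Route = print's: λ = Σ_{y′}Δ(y′)λ, (3.42) block by block on the pieces, |Δ(y′)λ| ≦ (L^{j′}η)^γ|λ|_{(γ)}, e^{−δ₀d} =
e^{−(1−α)δ₀d}·e^{−αδ₀d}, scale transfer (p27's `scaleTransfer_of_260` + `weight_ratio`, one factor L^{|γ|} ≦ L⁴ per unit),
(2.61), then `glob_le`. [cite: Balaban1985BackgroundPropagators, (3.42) p.397 + (3.47) p.398; Balaban1984PropagatorsII, Lemma 2.1 (2.60)–(2.61) p.234] -/
theorem globBlockOn_of_eBlockOn {K : B9.KernelFamily g B} {P : g.Loc → Prop} {U : B.Cfg} {res : g.Site → g.Loc → g.Loc}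
    (hR : GlobReading K P U res) (d : ℕ) {δ₀ α B₀ : ℝ} (hB₀ : 0 ≤ B₀) (hL : 1 ≤ g.L) (hη : 0 < g.eta)
    (hw : ∀ (γ : ℝ) (lam : g.Loc), 0 ≤ g.wNorm γ lam) (hsize : 4 * Real.log g.L ≤ α * δ₀ * R * g.M)
    (h260 : Ineq260 (toB6 g R H) δ₀ α) (h261 : Ineq261 d (toB6 g R H) δ₀ (1 - α)) (hE : EBlockOn K P B₀ δ₀ U) :
    GlobBlockOn K P (B₀ * B6.c1 d δ₀ (1 - α) * g.L ^ (4 : ℝ)) U := by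
  intro n lam γ hP h1 h2
  have hγ : |γ| ≤ 4 := abs_le.2 ⟨by linarith, h2⟩
  have hL0 : 0 < g.L := lt_of_lt_of_le one_pos hL
  obtain ⟨hsz, hL4⟩ := size_condition_compact g.L γ _ hL hγ hsize
  have hST : ScaleTransfer g δ₀ α (g.L ^ |γ|) (fun y => (g.len y) ^ γ) :=
    scaleTransfer_of_260 g δ₀ α (Real.exp (-(α * δ₀ * R * g.M))) (g.L ^ |γ|) (fun y => (g.len y) ^ γ)
      (fun y y' => Nat.dist (g.scale y) (g.scale y')) (Real.exp_nonneg _) (Real.one_le_rpow hL (abs_nonneg γ))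
      (rpow_abs_mul_exp_le_one g.L γ _ hL0 hsz) (weight_nonneg g hL0 hη γ)
      (h260_nat_of_Ineq260 g R H δ₀ α h260) (fun y y' => weight_ratio g hL hη γ y y')
  set N := g.wNorm γ lam with hNdef
  have hN : 0 ≤ N := hw γ lam
  have hc1 : 0 ≤ B6.c1 d δ₀ (1 - α) := c1_nonneg d δ₀ (1 - α)
  have hΛ : 0 ≤ g.L ^ |γ| := Real.rpow_nonneg hL0.le _
  have hC : 0 ≤ B₀ * B6.c1 d δ₀ (1 - α) * g.L ^ (4 : ℝ) * N :=
    mul_nonneg (mul_nonneg (mul_nonneg hB₀ hc1) (Real.rpow_nonneg hL0.le _)) hN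
  refine hR.glob_le n lam γ _ hP hC fun y => ?_
  have hpref : 0 ≤ B9.pref4 (g.len y) n := B9FromB6.pref4_nonneg (len_nonneg' hL hη y) n
  have hwy : 0 ≤ (g.len y) ^ γ := weight_nonneg g hL0 hη γ y
  have hK : 0 ≤ B₀ * B9.pref4 (g.len y) n * N := mul_nonneg (mul_nonneg hB₀ hpref) hN
  -- the exponential split e^{−δ₀d} = e^{−(1−α)δ₀d}·e^{−αδ₀d}
  have hsplit : ∀ y' : g.Site, Real.exp (-(δ₀ * g.dist y y')) =
      Real.exp (-((1 - α) * δ₀ * g.dist y y')) * Real.exp (-(α * δ₀ * g.dist y y')) := by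
    intro y'
    rw [← Real.exp_add]
    congr 1
    ring
  calc K.e n U lam y ≤ ∑ y' : g.Site, K.e n U (res y' lam) y := hR.e_subadd n lam y hP
    _ ≤ ∑ y' : g.Site, B₀ * B9.pref4 (g.len y) n * Real.exp (-(δ₀ * g.dist y y')) * ((g.len y') ^ γ * N) :=
        Finset.sum_le_sum fun y' _ =>
          (hE n (res y' lam) y y' (hR.res_P y' lam hP) (hR.res_supp y' lam hP)).trans
            (mul_le_mul_of_nonneg_left (hR.res_norm y' lam γ hP)
              (mul_nonneg (mul_nonneg hB₀ hpref) (Real.exp_nonneg _)))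
    _ = B₀ * B9.pref4 (g.len y) n * N * ∑ y' : g.Site, Real.exp (-((1 - α) * δ₀ * g.dist y y')) *
          (Real.exp (-(α * δ₀ * g.dist y y')) * (g.len y') ^ γ) := by
        rw [Finset.mul_sum]
        refine Finset.sum_congr rfl fun y' _ => ?_
        rw [hsplit y']
        ring
    _ ≤ B₀ * B9.pref4 (g.len y) n * N * ∑ y' : g.Site, Real.exp (-((1 - α) * δ₀ * g.dist y y')) *
          (g.L ^ |γ| * (g.len y) ^ γ) := by
        refine mul_le_mul_of_nonneg_left (Finset.sum_le_sum fun y' _ => ?_) hK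
        exact mul_le_mul_of_nonneg_left (hST y y') (Real.exp_nonneg _)
    _ = B₀ * B9.pref4 (g.len y) n * N * (g.L ^ |γ| * (g.len y) ^ γ) *
          ∑ y' : g.Site, Real.exp (-((1 - α) * δ₀ * g.dist y y')) := by
        rw [← Finset.sum_mul]
        ring
    _ ≤ B₀ * B9.pref4 (g.len y) n * N * (g.L ^ |γ| * (g.len y) ^ γ) * B6.c1 d δ₀ (1 - α) :=
        mul_le_mul_of_nonneg_left (h261 y) (mul_nonneg hK (mul_nonneg hΛ hwy))
    _ = (B₀ * B6.c1 d δ₀ (1 - α) * g.L ^ |γ| * N) * B9.pref4 (g.len y) n * (g.len y) ^ γ := by ring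
    _ ≤ (B₀ * B6.c1 d δ₀ (1 - α) * g.L ^ (4 : ℝ) * N) * B9.pref4 (g.len y) n * (g.len y) ^ γ := by
        have h4 : B₀ * B6.c1 d δ₀ (1 - α) * g.L ^ |γ| * N ≤ B₀ * B6.c1 d δ₀ (1 - α) * g.L ^ (4 : ℝ) * N :=
          mul_le_mul_of_nonneg_right (mul_le_mul_of_nonneg_left hL4 (mul_nonneg hB₀ hc1)) hN
        exact mul_le_mul_of_nonneg_right (mul_le_mul_of_nonneg_right h4 hpref) hwy

/-- The same with the conclusion weakened to any B₀′ ≧ B₀c₁(1−α)L⁴ (for merging constants across a family).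
[cite: Balaban1985BackgroundPropagators, (3.42) p.397 + (3.47) p.398] -/
theorem globBlockOn_of_eBlockOn_le {K : B9.KernelFamily g B} {P : g.Loc → Prop} {U : B.Cfg} {res : g.Site → g.Loc → g.Loc}
    (hR : GlobReading K P U res) (d : ℕ) {δ₀ α B₀ B₀' : ℝ} (hB₀ : 0 ≤ B₀) (hL : 1 ≤ g.L) (hη : 0 < g.eta)
    (hw : ∀ (γ : ℝ) (lam : g.Loc), 0 ≤ g.wNorm γ lam) (hsize : 4 * Real.log g.L ≤ α * δ₀ * R * g.M)
    (h260 : Ineq260 (toB6 g R H) δ₀ α) (h261 : Ineq261 d (toB6 g R H) δ₀ (1 - α)) (hE : EBlockOn K P B₀ δ₀ U)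
    (hB' : B₀ * B6.c1 d δ₀ (1 - α) * g.L ^ (4 : ℝ) ≤ B₀') : GlobBlockOn K P B₀' U :=
  fun n lam γ hP h1 h2 =>
    (globBlockOn_of_eBlockOn hR d hB₀ hL hη hw hsize h260 h261 hE n lam γ hP h1 h2).trans
      (mul_le_mul_of_nonneg_right hB' (hw γ lam))

/-- The same from the unrestricted (3.42) block `B9FromB6.EBlock`. [cite: Balaban1985BackgroundPropagators, (3.42) p.397 + (3.47) p.398] -/
theorem globBlockOn_of_eBlock {K : B9.KernelFamily g B} {P : g.Loc → Prop} {U : B.Cfg} {res : g.Site → g.Loc → g.Loc}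
    (hR : GlobReading K P U res) (d : ℕ) {δ₀ α B₀ : ℝ} (hB₀ : 0 ≤ B₀) (hL : 1 ≤ g.L) (hη : 0 < g.eta)
    (hw : ∀ (γ : ℝ) (lam : g.Loc), 0 ≤ g.wNorm γ lam) (hsize : 4 * Real.log g.L ≤ α * δ₀ * R * g.M)
    (h260 : Ineq260 (toB6 g R H) δ₀ α) (h261 : Ineq261 d (toB6 g R H) δ₀ (1 - α)) (hE : EBlock K B₀ δ₀ U) :
    GlobBlockOn K P (B₀ * B6.c1 d δ₀ (1 - α) * g.L ^ (4 : ℝ)) U :=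
  globBlockOn_of_eBlockOn hR d hB₀ hL hη hw hsize h260 h261 (eBlockOn_of_eBlock hE)

end Member

/-! ## §3 The family at U = 1: the (3.42) leaf ⇒ the (3.47) leaf -/

section Family

variable {I : Type}

/-- **The (3.42) leaf at U = 1 ON `P`** (one threshold M₁, one pair (B₀, δ₀) > 0; for G′(1) = [4] Prop. 2.2 (2.67), for
G(1) = [4] Prop. 2.6 (2.136) — in the tree through the `U = 1` comparisons of `B9FromB6.DictAtOne` against NODE 00's readings).
[cite: Balaban1985BackgroundPropagators, Cor. 3.5 p.407 + (3.42) p.397; Balaban1984PropagatorsII, (2.67) p.234 + (2.136) p.247] -/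
def AtOneEOn (geo : I → B9.Geometry) (bg : I → B9.Backgrounds) (K : ∀ i, B9.KernelFamily (geo i) (bg i))
    (P : ∀ i, (geo i).Loc → Prop) : Prop :=
  ∃ M₁ B₀ δ₀ : ℝ, 0 < M₁ ∧ 0 < B₀ ∧ 0 < δ₀ ∧ ∀ i : I, M₁ ≤ (geo i).M → EBlockOn (K i) (P i) B₀ δ₀ (bg i).one

/-- **[4] Lemma 2.1 IN ITS PRINTED «RM SUFFICIENTLY LARGE» FORM, for the family, at the rate δ₀ and an exponent α**: an M-threshold
above which every member's transported geometry satisfies (2.60) at α, (2.61) at 1 − α, and the size condition 4·log L ≦ αδ₀RM of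
the scale transfer ((2.59): *"RM ≧ …"*).  A hypothesis schema (in the tree for NODE 00's k-level tori: dag-p1's
`B6Lemma21ParamKLevelTorus`, N03's [4] block). [cite: Balaban1984PropagatorsII, Lemma 2.1 (2.59)–(2.61) pp.233–234] -/
def Lemma21Above (d : ℕ) (geo : I → B9.Geometry) [∀ i, Fintype (geo i).Site] (R : I → ℝ) (H : I → Prop)
    (δ₀ α ML : ℝ) : Prop :=
  ∀ i : I, ML ≤ (geo i).M → Ineq260 (toB6 (geo i) (R i) (H i)) δ₀ α ∧ Ineq261 d (toB6 (geo i) (R i) (H i)) δ₀ (1 - α) ∧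
    4 * Real.log (geo i).L ≤ α * δ₀ * R i * (geo i).M

variable {geo : I → B9.Geometry} [∀ i, Fintype (geo i).Site] {bg : I → B9.Backgrounds}
  {K : ∀ i, B9.KernelFamily (geo i) (bg i)} {P Q : ∀ i, (geo i).Loc → Prop}

omit [∀ i, Fintype (geo i).Site] in
/-- the (3.42) leaf at U = 1 is the restriction of `B9FromB6`'s unrestricted one (e.g. of the first conjunct of
`B9.BaseU1Printed`'s block at every member). [cite: Balaban1985BackgroundPropagators, (3.42) p.397 (bookkeeping)] -/
theorem atOneEOn_of_eBlock {M₁ B₀ δ₀ : ℝ} (hM : 0 < M₁) (hB : 0 < B₀) (hδ : 0 < δ₀)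
    (h : ∀ i : I, M₁ ≤ (geo i).M → EBlock (K i) B₀ δ₀ (bg i).one) : AtOneEOn geo bg K P :=
  ⟨M₁, B₀, δ₀, hM, hB, hδ, fun i hi => eBlockOn_of_eBlock (h i hi)⟩

/-- ★ **THE (3.47) LEAF AT U = 1 FROM THE (3.42) LEAF AT U = 1, [4] LEMMA 2.1 AND THE READINGS** — the family form of
`globBlockOn_of_eBlockOn`: the (3.42) leaf ON `P` (threshold M₁, constants (B₀, δ₀)), Lemma 2.1 above a threshold M_L at that δ₀
and some 0 < α < 1 (`Lemma21Above`), a common L ≧ 1 with L_i ≦ L, η_i > 0, |·|_{(γ)} ≧ 0 (the sign facts `ModelSignsOn`), and the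
reading axioms at every member give `AtOneGlobOn geo bg K P` with threshold max(M₁, M_L) and constant B₀c₁(1−α)L⁴.
[cite: Balaban1985BackgroundPropagators, Cor. 3.5 p.407 + (3.42) p.397 + (3.47) p.398; Balaban1984PropagatorsII, Lemma 2.1 p.234] -/
theorem atOneGlobOn_of_atOneEOn (S : ∀ i, ModelSignsOn (geo i) (Q i)) {res : ∀ i, (geo i).Site → (geo i).Loc → (geo i).Loc}
    (hR : ∀ i, GlobReading (K i) (P i) (bg i).one (res i)) (d : ℕ) {R : I → ℝ} {H : I → Prop} {α L : ℝ} (hL : 1 ≤ L)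
    (hL1 : ∀ i, 1 ≤ (geo i).L) (hLle : ∀ i, (geo i).L ≤ L) (hη : ∀ i, 0 < (geo i).eta)
    (hL21 : ∀ δ₀ : ℝ, 0 < δ₀ → ∃ ML : ℝ, Lemma21Above d geo R H δ₀ α ML) (hE : AtOneEOn geo bg K P) :
    AtOneGlobOn geo bg K P := by
  obtain ⟨M₁, B₀, δ₀, hM₁, hB₀, hδ₀, HE⟩ := hE
  obtain ⟨ML, HL⟩ := hL21 δ₀ hδ₀
  have hc1 : 0 ≤ B6.c1 d δ₀ (1 - α) := c1_nonneg d δ₀ (1 - α)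
  have hL4 : ∀ i, (geo i).L ^ (4 : ℝ) ≤ L ^ (4 : ℝ) := fun i =>
    Real.rpow_le_rpow (le_trans zero_le_one (hL1 i)) (hLle i) (by norm_num)
  refine ⟨max M₁ ML, B₀ * B6.c1 d δ₀ (1 - α) * L ^ (4 : ℝ) + 1, lt_max_of_lt_left hM₁,
    lt_of_le_of_lt (mul_nonneg (mul_nonneg hB₀.le hc1) (Real.rpow_nonneg (le_trans zero_le_one hL) _)) (lt_add_one _),
    fun i hi => ?_⟩
  obtain ⟨h260, h261, hsize⟩ := HL i (le_trans (le_max_right _ _) hi)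
  refine globBlockOn_of_eBlockOn_le (hR i) d hB₀.le (hL1 i) (hη i) (S i).wNorm_nonneg hsize h260 h261
    (HE i (le_trans (le_max_left _ _) hi)) ?_
  exact (mul_le_mul_of_nonneg_left (hL4 i) (mul_nonneg hB₀.le hc1)).trans (le_add_of_nonneg_right zero_le_one)

/-- ★ **THE KNIT'S `ResidualGAGlobAtOne geo bg K` FROM THE (3.42) LEAF AT U = 1 ON `P`, LEMMA 2.1, THE READINGS, AND THE NULL
READING OFF `P`** (`atOneGlobOn_of_atOneEOn` + `B9ResidualEntriesAtOne.residualGAGlobAtOne_of_globOn_of_null`).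
[cite: Balaban1985BackgroundPropagators, Cor. 3.5 p.407 + (3.47) p.398; Balaban1984PropagatorsII, Lemma 2.1 p.234] -/
theorem residualGAGlobAtOne_of_atOneEOn_of_null (S : ∀ i, ModelSignsOn (geo i) (Q i))
    {res : ∀ i, (geo i).Site → (geo i).Loc → (geo i).Loc} (hR : ∀ i, GlobReading (K i) (P i) (bg i).one (res i)) (d : ℕ)
    {R : I → ℝ} {H : I → Prop} {α L : ℝ} (hL : 1 ≤ L) (hL1 : ∀ i, 1 ≤ (geo i).L) (hLle : ∀ i, (geo i).L ≤ L)
    (hη : ∀ i, 0 < (geo i).eta) (hL21 : ∀ δ₀ : ℝ, 0 < δ₀ → ∃ ML : ℝ, Lemma21Above d geo R H δ₀ α ML)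
    (hnull : ∀ (i : I) (n : Fin 4) (lam : (geo i).Loc) (γ : ℝ), ¬ P i lam → (K i).glob n (bg i).one lam γ ≤ 0)
    (hE : AtOneEOn geo bg K P) : ResidualGAGlobAtOne geo bg K :=
  residualGAGlobAtOne_of_globOn_of_null S hnull (atOneGlobOn_of_atOneEOn S hR d hL hL1 hLle hη hL21 hE)

end Family

/-! ## §4 At the Stage-3′(Y) carriers over def-Y's operator-layer signature -/

section StageY

variable {d ℓ : ℕ} {hd : 1 ≤ d + 1} {hL : Odd (ℓ + 1) ∧ 1 < ℓ + 1} {b₀ b₁ : ℝ} {Mstar : ℕ}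
variable {𝔸 : Type} [NormedRing 𝔸] [NormedAlgebra ℂ 𝔸] [CompleteSpace 𝔸] {G : Subgroup 𝔸ˣ}
/-- `L = ℓ + 1 ≥ 1` at every member (the k-level geometry's `L` field is the family's `L`). [cite: Balaban1984PropagatorsII, (2.1) p.224 (bookkeeping)] -/
theorem geo9Y_L (x : MemberY d ℓ hd hL b₀ b₁ Mstar) : (geo9Y x).L = ((ℓ + 1 : ℕ) : ℝ) := rfl

/-- `1 ≤ ℓ + 1` in `ℝ`. [folklore] -/
private theorem ell_succ_one_le : (1 : ℝ) ≤ ((ℓ + 1 : ℕ) : ℝ) := by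
  exact_mod_cast Nat.succ_le_succ (Nat.zero_le ℓ)

variable (ops : ∀ x : MemberY d ℓ hd hL b₀ b₁ Mstar, OperatorLayerY d ℓ hd hL b₀ b₁ Mstar 𝔸 G x)
  [∀ x : MemberY d ℓ hd hL b₀ b₁ Mstar, Fintype (geo9Y x).Site]

/-- ★ **THE KNIT BINDER `hGA` FROM THE (3.42) LEAF OF G(1) ON BOND ARGUMENTS + [4] LEMMA 2.1 AT THE MEMBERS + THE GLOB-READINGS OF
`(ops ·).GA` + THE NULL READING ON SITE ARGUMENTS.**  The (3.42) leaf is, at NODE 00's reading, [4] Prop. 2.6 (2.136) (N03, discharged)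
transported through the `U = 1` comparison `hGA_e`; Lemma 2.1 at the members is N03's [4] block; the readings and the null reading
hold by construction at an operator layer reading G on the bond summand (def-Y's instance).  All four enter here AS HYPOTHESES.
[cite: Balaban1985BackgroundPropagators, Cor. 3.5 p.407 + (3.42) p.397 + (3.47) p.398; Balaban1984PropagatorsII, Prop. 2.6 (2.136) p.247 + Lemma 2.1 p.234] -/
theorem hGA_of_atOneEOn_reading {dd : ℕ} {R : MemberY d ℓ hd hL b₀ b₁ Mstar → ℝ} {H : MemberY d ℓ hd hL b₀ b₁ Mstar → Prop} {α : ℝ}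
    {res : ∀ x : MemberY d ℓ hd hL b₀ b₁ Mstar, (geo9Y x).Site → (geo9Y x).Loc → (geo9Y x).Loc}
    (hR : ∀ x, GlobReading (ops x).GA (fun lam => lam.isRight = true) (bg9Y 𝔸 G x).one (res x))
    (hη : ∀ x : MemberY d ℓ hd hL b₀ b₁ Mstar, 0 < (geo9Y x).eta)
    (hL21 : ∀ δ₀ : ℝ, 0 < δ₀ → ∃ ML : ℝ, Lemma21Above dd geo9Y R H δ₀ α ML)
    (hnull : ∀ (x : MemberY d ℓ hd hL b₀ b₁ Mstar) (n : Fin 4) (lam : (geo9Y x).Loc) (γ : ℝ), ¬ (lam.isRight = true) →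
      (ops x).GA.glob n (bg9Y 𝔸 G x).one lam γ ≤ 0)
    (hE : AtOneEOn geo9Y (bg9Y 𝔸 G) (fun x => (ops x).GA) (fun _ lam => lam.isRight = true)) :
    ResidualGAGlobAtOne geo9Y (bg9Y 𝔸 G) (fun x => (ops x).GA) :=
  residualGAGlobAtOne_of_atOneEOn_of_null (fun x => B9GeoNormsKLevelModelSignsV1.modelSignsOn_geo9K x.toKIdx) hR dd
    (L := ((ℓ + 1 : ℕ) : ℝ)) ell_succ_one_le (fun _ => ell_succ_one_le) (fun _ => le_rfl) hη hL21 hnull hE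

/-- **THE (3.47) MEMBER OF `hGp` LIKEWISE**: the (3.47) leaf of G′(1) at U = 1 ON SITE ARGUMENTS (`AtOneGlobOn …`, the `hG` input of
`B9ResidualEntriesAtOne.hGp_of_blocksOn_of_null`) from the (3.42) leaf of G′(1) on site arguments ([4] Prop. 2.2 (2.67) at NODE 00's
reading, through `hGp_e`), Lemma 2.1 at the members and the glob-readings of `(ops ·).Gp`.
[cite: Balaban1985BackgroundPropagators, Cor. 3.5 p.407 + (3.42) p.397 + (3.47) p.398; Balaban1984PropagatorsII, Prop. 2.2 (2.67) p.234 + Lemma 2.1 p.234] -/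
theorem atOneGlobOn_Gp_of_atOneEOn_reading {dd : ℕ} {R : MemberY d ℓ hd hL b₀ b₁ Mstar → ℝ}
    {H : MemberY d ℓ hd hL b₀ b₁ Mstar → Prop} {α : ℝ}
    {res : ∀ x : MemberY d ℓ hd hL b₀ b₁ Mstar, (geo9Y x).Site → (geo9Y x).Loc → (geo9Y x).Loc}
    (hR : ∀ x, GlobReading (ops x).Gp (fun lam => ¬ (lam.isRight = true)) (bg9Y 𝔸 G x).one (res x))
    (hη : ∀ x : MemberY d ℓ hd hL b₀ b₁ Mstar, 0 < (geo9Y x).eta)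
    (hL21 : ∀ δ₀ : ℝ, 0 < δ₀ → ∃ ML : ℝ, Lemma21Above dd geo9Y R H δ₀ α ML)
    (hE : AtOneEOn geo9Y (bg9Y 𝔸 G) (fun x => (ops x).Gp) (fun _ lam => ¬ (lam.isRight = true))) :
    AtOneGlobOn geo9Y (bg9Y 𝔸 G) (fun x => (ops x).Gp) (fun _ lam => ¬ (lam.isRight = true)) :=
  atOneGlobOn_of_atOneEOn (fun x => B9GeoNormsKLevelModelSignsV1.modelSignsOn_geo9K x.toKIdx) hR dd
    (L := ((ℓ + 1 : ℕ) : ℝ)) ell_succ_one_le (fun _ => ell_succ_one_le) (fun _ => le_rfl) hη hL21 hE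

end StageY

end Literature.MathematicalPhysics.QuantumFieldTheory.Balaban1983to89.B9Ineq347Reading

end
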